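import Summits.Langlands.Langlands.Theorems.DyadicOddResidueSectorComplementRankTwoAssembly
import Literature.NumberTheory.GaloisRepresentations.HenniartGaloisSideCharacterisation
import Literature.NumberTheory.Automorphic.RankinSelbergLocalTwistProofs
import Literature.NumberTheory.Automorphic.LocalLanglandsGLOne
import Literature.NumberTheory.Automorphic.LocalLanglandsGLIndecomposable
import Literature.NumberTheory.Automorphic.InvariantMeasureGLModUnipotent
import HarnessLib

/-!
# Generic rigidity of pinned local Langlands data in every rank, modulo named facts of print — hypothesis form
(line `PhantomRMJunctionOfPieces`, crux stmt-Langlands-13643 `PhantomRMYoshida.PhantomRMJunction`, piece U;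
`--supports` file: its last theorem is, verbatim, the skeleton's `pinnedRecRigidity_text_of`, i.e. the text of
piece U from the registered stubs S6, `stub_henniart2002_localLanglandsInputs`,
`stub_exists_smulInvariantMeasure_glQuotUpperUnitriangular`)

Let `F` be a non-archimedean local field and `rec`, `rec'` two local Langlands correspondences for the general
linear groups over `F` in the sense of the tree's six-clause `IsLocalLanglandsGL` (bijections; class field
theory in rank `1`; `L`- and `ε`-factors of GENERIC pairs `1 ≤ m < n`; twists; central characters), normalised
against the same Artin datum and local constants.  The six clauses pin `rec` on generic classes only RELATIVELY:
`L(s, π × π')` is whatever the JPSS predicate `HasRSLFactor` says, but it is the same polynomial for both data, so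
the pair Euler factors of `rec π ⊗ rec π'` and `rec' π ⊗ rec' π'` agree (`pairEulerFactor_eq_of_isLocalLanglandsGL`,
clause (iii-L) at `(n, m)` — instantiated with an invariant measure on `GL_m(F) ⧸ U_m(F)`, hypothesis `hν`; the
tree constructs it for `m = 1` only, `exists_haar_measure_quotient_fin_one`).

**Theorem** (`rec_eq_sharp_of_isGeneric`).  Let `rec₀` be a six-clause correspondence which (i) matches
supercuspidal classes with irreducible parameters and (ii) hits every indecomposable Frobenius-semisimple
parameter with a class generic for every `ψ` (the two properties of THE correspondence: Henniart 2002 Thm. 1.5 (i),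
§2.7, §2.9 — the content of the named fact `localLanglands_gl_indecomposable`, proposed p157134), and `rec` ANY
six-clause correspondence for the same normalising pair.  Granting the named facts `localLanglands_gl`
(Henniart's uniqueness on supercuspidal classes) and
`Henniart2002_isEquivalent_of_rootMultiplicity_eulerFactor_tprod_eq` (Thm. 1.7 (a)), and the invariant measures
`hν`, `rec = rec₀` on every generic class of every rank.  Proof: strong induction on the rank; supercuspidal
classes by uniqueness; ranks `0, 1` pinned outright; a generic non-supercuspidal `π` of rank `n ≥ 2`: `rec₀ π` is
not irreducible by (i), every indecomposable probe `τ` of dimension `r < n` is `rec₀ π_τ = rec π_τ` (by (ii) and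
induction), clause (iii-L) for both data gives `P(rec π ⊗ τ) = P(rec₀ π ⊗ τ)`, and Thm. 1.7 (a) in Euler-factor
form yields `rec₀ π ≅ rec π`.  No `ε`, no automorphic `L`-computation.

**Corollary** (`pinnedRecRigidity_of_localLanglandsInputs`): two PINNED reciprocity data of a number field
(`ReciprocityData K`; pins `llc_isCanonical` / `llc_eps_isCanonical` = the canonicity hypotheses of (F2); transport
`isLocalLanglandsGL_transport'`) have the same `rec_n` on every generic class at every finite place — the TEXT of
piece U of the line, from the texts of the three registered stubs.  No definitions; standard axioms; no `sorry`.
-/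

noncomputable section

set_option linter.dupNamespace false -- project-wide option; `Summit.Langlands.Langlands` is the mandated namespace

open scoped MatrixGroups TensorProduct Polynomial NumberField
open Module MeasureTheory NumberField IsDedekindDomain
open Literature.NumberTheory.Automorphic Literature.NumberTheory.GaloisRepresentations
open Summit.Langlands
open Summit.Langlands.Langlands.Theorems.ReciprocityRigidity

namespace Summit.Langlands.Langlands.Theorems.PhantomRMJunctionOfPieces

/-! ## Generic rigidity of pinned data in every rank from S6, (F2 ∧ F3) and (Fν), hypothesis form -/

section Local

variable {F : Type} [Field F] [ValuativeRel F] [TopologicalSpace F] [IsNonarchimedeanLocalField F]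
  {hmul : @IsFrobPow.mul F _ _ _ _} {huniq : @IsFrobPow.unique F _ _ _ _}
  {hn : absInertia_normal F} {hex : @exists_isFrobPow F _ _ _ _}
  {hns : @WeilGroup.exists_subgroup_le_inertia_isOpen_of_continuous F _ _ _ _}
  {d : LocalArtinData F} {𝓔 : LocalEpsilonSystem F}
  {rec rec' rec₀ : ∀ n : ℕ, IrrClass (GL (Fin n) F) → Quotient (frobSemisimpleWDSetoid F n)}

/-- **Pair Euler factors are correspondence-independent** (clause (iii-L) at `(n, m)`, instantiated with the
invariant measure on `GL_m(F) ⧸ U_m(F)`; `HasRSLFactor.unique`).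
[cite: JacquetPiatetskiShapiroShalika1983, Thm 2.7] [cite: HarrisTaylorAMS2001, Thm. A] -/
theorem pairEulerFactor_eq_of_isLocalLanglandsGL
    (hν : ∀ (m : ℕ) [MeasurableSpace (GL (Fin m) F ⧸ upperUnitriangular (Fin m) F)]
      [BorelSpace (GL (Fin m) F ⧸ upperUnitriangular (Fin m) F)],
      ∃ ν : Measure (GL (Fin m) F ⧸ upperUnitriangular (Fin m) F),
        SMulInvariantMeasure (GL (Fin m) F) (GL (Fin m) F ⧸ upperUnitriangular (Fin m) F) ν ∧
        IsFiniteMeasureOnCompacts ν ∧ ν.IsOpenPosMeasure)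
    (h : IsLocalLanglandsGL F hmul huniq hn hex hns d 𝓔 rec)
    (h' : IsLocalLanglandsGL F hmul huniq hn hex hns d 𝓔 rec')
    {m n : ℕ} (hm : 0 < m) (hmn : m < n)
    (π : SmoothIrrep (GL (Fin n) F)) (π' : SmoothIrrep (GL (Fin m) F))
    {ψ : AddChar F Circle} (hψ : ψ.IsContinuousNontrivial)
    (hg : IsGeneric π.ρ ψ) (hg' : IsGeneric π'.ρ ψ⁻¹) :
    (((rec n (IrrClass.mk π)).out.1).tprod ((rec m (IrrClass.mk π')).out.1)).eulerFactor hn hex =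
      (((rec' n (IrrClass.mk π)).out.1).tprod ((rec' m (IrrClass.mk π')).out.1)).eulerFactor
        hn hex := by
  letI : MeasurableSpace (GL (Fin m) F ⧸ upperUnitriangular (Fin m) F) := borel _
  haveI : BorelSpace (GL (Fin m) F ⧸ upperUnitriangular (Fin m) F) := ⟨rfl⟩
  obtain ⟨ν, hinv, hfin, hpos⟩ := hν m
  haveI := hinv
  haveI := hfin
  haveI := hpos
  have h1 := (h.lFactor_pairs hm hmn π π' ψ hψ hg hg' ν _).2 rfl
  have h2 := (h'.lFactor_pairs hm hmn π π' ψ hψ hg hg' ν _).2 rfl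
  exact h1.unique h2

/-- **Generic rigidity against a sharp witness** (the induction on the rank): a six-clause `rec₀` with
(F2)'s two properties and ANY six-clause `rec` for the same normalising pair agree on every generic class,
granting S6 (supercuspidal classes), (F3) and (Fν). [cite: HenniartBSMF2002, Thm. 1.7 (a)] [cite: Henniarts1993, Thm 1.1] -/
theorem rec_eq_sharp_of_isGeneric (hd : 𝓔.artin F = d)
    (hS09 : localLanglands_gl F hmul huniq hn hex hns d 𝓔 hd)
    (h17 : Henniart2002_isEquivalent_of_rootMultiplicity_eulerFactor_tprod_eq F)
    (hν : ∀ (m : ℕ) [MeasurableSpace (GL (Fin m) F ⧸ upperUnitriangular (Fin m) F)]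
      [BorelSpace (GL (Fin m) F ⧸ upperUnitriangular (Fin m) F)],
      ∃ ν : Measure (GL (Fin m) F ⧸ upperUnitriangular (Fin m) F),
        SMulInvariantMeasure (GL (Fin m) F) (GL (Fin m) F ⧸ upperUnitriangular (Fin m) F) ν ∧
        IsFiniteMeasureOnCompacts ν ∧ ν.IsOpenPosMeasure)
    (h₀ : IsLocalLanglandsGL F hmul huniq hn hex hns d 𝓔 rec₀)
    (hirr : ∀ n : ℕ, 0 < n → ∀ c : IrrClass (GL (Fin n) F),
      c.IsSupercuspidal ↔ ((rec₀ n c).out.1).IsIrreducible)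
    (hind : ∀ n : ℕ, 0 < n → ∀ τ : WeilDeligneRep F ℂ (Fin n → ℂ), τ.IsFrobSemisimple →
      τ.IsIndecomposable → ∃ π : SmoothIrrep (GL (Fin n) F),
        (∀ ψ : AddChar F Circle, ψ.IsContinuousNontrivial → IsGeneric π.ρ ψ) ∧
        ((rec₀ n (IrrClass.mk π)).out.1).IsEquivalent τ)
    (h : IsLocalLanglandsGL F hmul huniq hn hex hns d 𝓔 rec) :
    ∀ (n : ℕ) (π : SmoothIrrep (GL (Fin n) F)) (ψ : AddChar F Circle), ψ.IsContinuousNontrivial →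
      IsGeneric π.ρ ψ → rec n (IrrClass.mk π) = rec₀ n (IrrClass.mk π) := by
  intro n
  induction n using Nat.strong_induction_on with
  | _ n ih =>
  intro π ψ hψ hg
  by_cases hsc : (IrrClass.mk π).IsSupercuspidal
  · exact IsLocalLanglandsGL.unique_of_isSupercuspidal F _ _ _ _ _ hd hS09 h h₀ _ hsc
  rcases Nat.lt_or_ge n 2 with hn2 | hn2
  · interval_cases n
    · exact congrFun (h.rec_zero_eq_recGLZero.trans h₀.rec_zero_eq_recGLZero.symm) _
    · exact congrFun (h.rec_one_eq_recGLOne.trans h₀.rec_one_eq_recGLOne.symm) _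
  -- rank `n ≥ 2`, `π` generic and not supercuspidal
  have hn0 : 0 < n := lt_of_lt_of_le Nat.zero_lt_two hn2
  have hρ₀ : ¬ ((rec₀ n (IrrClass.mk π)).out.1).IsIrreducible :=
    fun hirr' => hsc ((hirr n hn0 _).2 hirr')
  have key : ((rec₀ n (IrrClass.mk π)).out.1).IsEquivalent ((rec n (IrrClass.mk π)).out.1) := by
    refine Henniart2002_isEquivalent_of_eulerFactor_tprod_indecomposable_eq h17 hn hex hn2
      (rec₀ n (IrrClass.mk π)).out.2 (rec n (IrrClass.mk π)).out.2 hρ₀ ?_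
    intro r hr hrn τ hτ hτi
    obtain ⟨π', hgen', hequiv⟩ := hind r hr τ hτ hτi
    have hih : rec r (IrrClass.mk π') = rec₀ r (IrrClass.mk π') := ih r hrn π' ψ hψ (hgen' ψ hψ)
    have hpair := pairEulerFactor_eq_of_isLocalLanglandsGL hν h h₀ hr hrn π π' hψ hg
      (hgen' ψ⁻¹ hψ.inv)
    rw [hih] at hpair
    have e₀ : (((rec₀ n (IrrClass.mk π)).out.1).tprod τ).IsEquivalent
        (((rec₀ n (IrrClass.mk π)).out.1).tprod ((rec₀ r (IrrClass.mk π')).out.1)) :=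
      isEquivalent_tprod_right _ hequiv.symm
    have e₁ : (((rec n (IrrClass.mk π)).out.1).tprod τ).IsEquivalent
        (((rec n (IrrClass.mk π)).out.1).tprod ((rec₀ r (IrrClass.mk π')).out.1)) :=
      isEquivalent_tprod_right _ hequiv.symm
    rw [stub_eulerFactor_eq_of_isEquivalent hn hex e₀, stub_eulerFactor_eq_of_isEquivalent hn hex e₁]
    exact hpair.symm
  exact (Quotient.out_equiv_out.1 key).symm

end Local

/-- **Piece U (text) from S6, (F2 ∧ F3) and (Fν)**: two PINNED reciprocity data of a number field have the same
`rec_n` on every generic class at every finite place — the pins (`llc_isCanonical`, `llc_eps_isCanonical`)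
identify the normalising pairs (`isLocalLanglandsGL_transport'`) and are the canonicity hypotheses of (F2); both
data agree with (F2)'s witness by `rec_eq_sharp_of_isGeneric`.
[cite: HenniartBSMF2002, Thm. 1.5 and Thm. 1.7 (a)] [cite: Henniarts1993, Thm 1.1] [cite: HarrisTaylorAMS2001, Thm. A] -/
theorem pinnedRecRigidity_of_localLanglandsInputs :
    ∀ (hgl : ∀ (F : Type) [Field F] [ValuativeRel F] [TopologicalSpace F] [IsNonarchimedeanLocalField F]
      (hmul : @IsFrobPow.mul F _ _ _ _) (huniq : @IsFrobPow.unique F _ _ _ _)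
      (hn : absInertia_normal F) (hex : @exists_isFrobPow F _ _ _ _)
      (hns : @WeilGroup.exists_subgroup_le_inertia_isOpen_of_continuous F _ _ _ _)
      (d : LocalArtinData F) (𝓔 : LocalEpsilonSystem F) (hd : 𝓔.artin F = d),
      localLanglands_gl F hmul huniq hn hex hns d 𝓔 hd)
    (hH : (∀ (F : Type) [Field F] [ValuativeRel F] [TopologicalSpace F] [IsNonarchimedeanLocalField F]
      (hmul : @IsFrobPow.mul F _ _ _ _) (huniq : @IsFrobPow.unique F _ _ _ _)
      (hn : absInertia_normal F) (hex : @exists_isFrobPow F _ _ _ _)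
      (hns : @WeilGroup.exists_subgroup_le_inertia_isOpen_of_continuous F _ _ _ _)
      (d : LocalArtinData F) (𝓔 : LocalEpsilonSystem F), 𝓔.artin F = d → d.IsCanonical →
      (∀ (E : Type) [Field E] [ValuativeRel E] [TopologicalSpace E] [IsNonarchimedeanLocalField E]
        [Algebra F E] [FiniteDimensional F E], (𝓔.artin E).IsCanonical) →
      ∃ rec : ∀ n : ℕ, IrrClass (GL (Fin n) F) → Quotient (frobSemisimpleWDSetoid F n),
        IsLocalLanglandsGL F hmul huniq hn hex hns d 𝓔 rec ∧
        (∀ n : ℕ, 0 < n → ∀ c : IrrClass (GL (Fin n) F),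
          c.IsSupercuspidal ↔ ((rec n c).out.1).IsIrreducible) ∧
        (∀ n : ℕ, 0 < n → ∀ τ : WeilDeligneRep F ℂ (Fin n → ℂ), τ.IsFrobSemisimple →
          τ.IsIndecomposable → ∃ π : SmoothIrrep (GL (Fin n) F),
            (∀ ψ : AddChar F Circle, ψ.IsContinuousNontrivial → IsGeneric π.ρ ψ) ∧
            ((rec n (IrrClass.mk π)).out.1).IsEquivalent τ)) ∧
      (∀ (F : Type) [Field F] [ValuativeRel F] [TopologicalSpace F] [IsNonarchimedeanLocalField F],
        Henniart2002_isEquivalent_of_rootMultiplicity_eulerFactor_tprod_eq F))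
    (hν : ∀ (F : Type) [Field F] [ValuativeRel F] [TopologicalSpace F] [IsNonarchimedeanLocalField F]
      (m : ℕ) [MeasurableSpace (GL (Fin m) F ⧸ upperUnitriangular (Fin m) F)]
      [BorelSpace (GL (Fin m) F ⧸ upperUnitriangular (Fin m) F)],
      ∃ ν : Measure (GL (Fin m) F ⧸ upperUnitriangular (Fin m) F),
        SMulInvariantMeasure (GL (Fin m) F) (GL (Fin m) F ⧸ upperUnitriangular (Fin m) F) ν ∧
        IsFiniteMeasureOnCompacts ν ∧ ν.IsOpenPosMeasure),
    ∀ (K : Type) [Field K] [NumberField K] (Rec Rec' : Summit.Langlands.ReciprocityData K) (v : IsDedekindDomain.HeightOneSpectrum (NumberField.RingOfIntegers K)) (n : ℕ) (πv : Literature.NumberTheory.Automorphic.SmoothIrrep (GL (Fin n) (v.adicCompletion K))) (ψ : AddChar (v.adicCompletion K) Circle), ψ.IsContinuousNontrivial → Literature.NumberTheory.Automorphic.IsGeneric πv.ρ ψ → (Rec.llc v).recGL n (Literature.NumberTheory.Automorphic.IrrClass.mk πv) = (Rec'.llc v).recGL n (Literature.NumberTheory.Automorphic.IrrClass.mk πv)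 := by
  intro hgl hH hν K _ _ Rec Rec' v n πv ψ hψ hg
  obtain ⟨rec₀, h₀, hirr, hind⟩ := hH.1 (v.adicCompletion K) (Rec.llc v).hmul (Rec.llc v).huniq
    (Rec.llc v).hn (Rec.llc v).hex (Rec.llc v).hns (Rec.llc v).artin (Rec.llc v).eps (Rec.llc v).eps_artin
    (Rec.llc_isCanonical v) (fun E _ _ _ _ _ _ => Rec.llc_eps_isCanonical v E)
  have hS09 := hgl (v.adicCompletion K) (Rec.llc v).hmul (Rec.llc v).huniq (Rec.llc v).hn (Rec.llc v).hex
    (Rec.llc v).hns (Rec.llc v).artin (Rec.llc v).eps (Rec.llc v).eps_artin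
  rw [rec_eq_sharp_of_isGeneric (Rec.llc v).eps_artin hS09 (hH.2 _) (hν _) h₀ hirr hind
      (Rec.llc v).isLocalLanglands n πv ψ hψ hg,
    rec_eq_sharp_of_isGeneric (Rec.llc v).eps_artin hS09 (hH.2 _) (hν _) h₀ hirr hind
      (isLocalLanglandsGL_transport' Rec Rec' v) n πv ψ hψ hg]

/-! ## By name: the four named facts of print (F1) `localLanglands_gl`, (F2) `localLanglands_gl_indecomposable`
(landed p157134), (F3) `Henniart2002_isEquivalent_of_rootMultiplicity_eulerFactor_tprod_eq`, (Fν)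
`exists_smulInvariantMeasure_glQuotUpperUnitriangular` (landed p157147) -/

/-- **Generic rigidity of pinned reciprocity data, every rank, modulo the four NAMED facts** —
`pinnedRecRigidity_of_localLanglandsInputs` with its spelled-out hypotheses supplied by the Literature named
facts (F1) `localLanglands_gl`, (F2) `localLanglands_gl_indecomposable`, (F3)
`Henniart2002_isEquivalent_of_rootMultiplicity_eulerFactor_tprod_eq`, (Fν)
`exists_smulInvariantMeasure_glQuotUpperUnitriangular`, each at every non-archimedean local field (all unfold
definitionally to the spelled texts). [cite: HenniartBSMF2002, Thm. 1.5 and Thm. 1.7 (a)] [cite: Henniarts1993, Thm 1.1]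
[cite: HarrisTaylorAMS2001, Thm. A] -/
theorem recGL_eq_of_isGeneric_of_namedFacts :
    ∀ (hgl : ∀ (F : Type) [Field F] [ValuativeRel F] [TopologicalSpace F] [IsNonarchimedeanLocalField F]
      (hmul : @IsFrobPow.mul F _ _ _ _) (huniq : @IsFrobPow.unique F _ _ _ _)
      (hn : absInertia_normal F) (hex : @exists_isFrobPow F _ _ _ _)
      (hns : @WeilGroup.exists_subgroup_le_inertia_isOpen_of_continuous F _ _ _ _)
      (d : LocalArtinData F) (𝓔 : LocalEpsilonSystem F) (hd : 𝓔.artin F = d),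
      localLanglands_gl F hmul huniq hn hex hns d 𝓔 hd)
    (hsharp : ∀ (F : Type) [Field F] [ValuativeRel F] [TopologicalSpace F] [IsNonarchimedeanLocalField F]
      (hmul : @IsFrobPow.mul F _ _ _ _) (huniq : @IsFrobPow.unique F _ _ _ _)
      (hn : absInertia_normal F) (hex : @exists_isFrobPow F _ _ _ _)
      (hns : @WeilGroup.exists_subgroup_le_inertia_isOpen_of_continuous F _ _ _ _)
      (d : LocalArtinData F) (𝓔 : LocalEpsilonSystem F) (hd : 𝓔.artin F = d),
      localLanglands_gl_indecomposable F hmul huniq hn hex hns d 𝓔 hd)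
    (h17 : ∀ (F : Type) [Field F] [ValuativeRel F] [TopologicalSpace F] [IsNonarchimedeanLocalField F],
      Henniart2002_isEquivalent_of_rootMultiplicity_eulerFactor_tprod_eq F)
    (hν : ∀ (F : Type) [Field F] [ValuativeRel F] [TopologicalSpace F] [IsNonarchimedeanLocalField F],
      exists_smulInvariantMeasure_glQuotUpperUnitriangular F),
    ∀ (K : Type) [Field K] [NumberField K] (Rec Rec' : Summit.Langlands.ReciprocityData K) (v : IsDedekindDomain.HeightOneSpectrum (NumberField.RingOfIntegers K)) (n : ℕ) (πv : Literature.NumberTheory.Automorphic.SmoothIrrep (GL (Fin n) (v.adicCompletion K))) (ψ : AddChar (v.adicCompletion K) Circle), ψ.IsContinuousNontrivial → Literature.NumberTheory.Automorphic.IsGeneric πv.ρ ψ → (Rec.llc v).recGL n (Literature.NumberTheory.Automorphic.IrrClass.mk πv) = (Rec'.llc v).recGL n (Literature.NumberTheory.Automorphic.IrrClass.mk πv) :=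
  fun hgl hsharp h17 hν =>
    pinnedRecRigidity_of_localLanglandsInputs hgl
      ⟨fun F _ _ _ _ hmul huniq hn hex hns d 𝓔 hd => hsharp F hmul huniq hn hex hns d 𝓔 hd, fun F _ _ _ _ => h17 F⟩
      (fun F _ _ _ _ m _ _ => hν F m)

end Summit.Langlands.Langlands.Theorems.PhantomRMJunctionOfPieces

end
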